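import Summits.BirchSwinnertonDyer.BirchSwinnertonDyer.Theorems.PrintCf2SplitBadTwoCMShaLocalScalarInput
import HarnessLib

/-!
# Crux `PrintCf2.SplitBadTwoRankOneOfFacts` (item stmt-BirchSwinnertonDyer-20368), road α, S3c₂: (R-BV) FROM (F1), (F3), (H2) AND THE ONE
# LOCAL CM INPUT (H1-pts) — the hypotheses (F2) and (H1′) of `rBV_of_three_factor_values` DISCHARGED modulo (H1-pts)

Cell `bsd-print-cf2`, width seat `bsd-line-cf2-p1-w8` g2 (brick **B6g**, assembly); `--supports stmt-BirchSwinnertonDyer-20368` (helper,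
Theses-free). HONEST FRAMING: nothing here closes a crux or a stub; BSD is not proved by any of this; no summit statement is proved by this
seat. No definition, no named fact, no `sorry`. beyond-print theorem: no.

WHAT. -w7 g2's `RestrictedSelmerPair.rBV_of_three_factor_values` (p665606) = LEAD g12's residual (R-BV) VERBATIM from five typed inputs
(F1), (F2), (F3), (H1′), (H2). Two of them are about the CM summand `E[𝔮_r^∞]` at the strict place `v`: (F2) (the middle factor counts
`Ш(W/ℚ)[2^∞]`) and (H1′) (`Q_M ≤ ker loc_v`). By p669645 + p670747 both follow from ONE statement about rational local points at `v`,
(H1-pts) «`π` acts on `E(K_v) ⊗ ℤ₂` modulo torsion as the pinned scalar `1 − r`» (an equivariant extension `f_v` of `π` to `E(K̄_v)` with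
`(f_v − N₁) E(K_v) ⊆ 2^n E(K_v) + E[2^∞]`, `N₁ ≡ 1 − r (mod 2^n)`):
* §1 `comap_kummer_le_ker_resOfLe_of_cmScalar` — **(H1′) ⟸ (H1-pts)** (generic `p`: `Q_M ≤ ι_*⁻¹(localKerOver p ⊤ K_v)`, -w7 g2
  `comap_kummer_le_comap_localKerOver`, then (H1″) ⟸ (H1-pts), p670747);
* §2 **`rBV_of_factor_values_of_cmScalar`** — (R-BV) VERBATIM ⟸ (F1) ∧ (F3) ∧ (H2) ∧ (H1-pts) (the last quantified over the frame in the
  same binder currency as the other residual functions). RESIDUAL of (R-BV) after this file: (F1) local index at `v̄`, (F3) the Poitou–Tate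
  term, (H2) `r = 1` exhaustion at `v̄`, and (H1-pts) — all four LOCAL/PT statements; the `Ш`-side of the bottom value is closed.

References: A. Agboola, Compositio 143 (2007) §6 Props. 6.10–6.11, §8 Prop. 8.1 [Agboola2007]; R. Greenberg, LNM 1716 (1999) §2
[GreenbergLNM1716]; K. Rubin, LNM 1716 (1999) §3 [Rubin1999].
-/

noncomputable section

open scoped Classical

set_option linter.dupNamespace false
set_option autoImplicit false

open NumberField IsDedekindDomain Field
open Literature.NumberTheory.EllipticCurves Literature.NumberTheory.EllipticCurves.GreenbergSelmer
open Literature.NumberTheory.EllipticCurves.Castella2018.AcSelmer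
open Literature.NumberTheory.EllipticCurves.Agboola2007
open Literature.NumberTheory.EllipticCurves.ResKernel
open Literature.NumberTheory.GaloisRepresentations
open Summit.BirchSwinnertonDyer.BirchSwinnertonDyer.Theorems.PrintCf2.RestrictedSelmerPair

universe u

namespace Summit.BirchSwinnertonDyer.BirchSwinnertonDyer.Theorems.PrintCf2.CMPrimes

/-! ## §1 (H1′) from the CM scalar on local points -/

section Generic

variable {K : Type u} [Field K] [NumberField K] (V : WeierstrassCurve K) [V.IsElliptic] (p : ℕ) [Fact p.Prime]
  (π : V.endRing) (r : ℤ_[p]) (v : HeightOneSpectrum (𝓞 K))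

/-- **(H1′) ⟸ (H1-pts): the canonical Kummer subgroup `Q_M = ι_*⁻¹(res_⊤(range κ))` of the summand `M = E[𝔮_r^∞]` is STRICT at `v`**
(`Q_M ≤ ker res_{⊤ ⊓ D_v}`), for complementary eigen-summands and an equivariant extension `f_v` of `π` to `E(K̄_v)` acting on `E(K_v) ⊗ ℤ_p`
modulo torsion as `1 − r` (Kummer classes are classical at `v`, -w7 g2 `comap_kummer_le_comap_localKerOver`; then p670747).
[cite: GreenbergLNM1716, §2 Prop. 2.1–2.2 (pp. 70–73)] [cite: Agboola2007, §3 (arXiv p0008:L58–64)] -/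
theorem comap_kummer_le_ker_resOfLe_of_cmScalar
    (hinf : V.endEigenPrimaryTorsion p π r ⊓ V.endEigenPrimaryTorsion p π (1 - r) = ⊥)
    (hsup : V.endEigenPrimaryTorsion p π r ⊔ V.endEigenPrimaryTorsion p π (1 - r) = ⊤) (hunit : IsUnit (r - (1 - r)))
    (fE : localPoints V (v.adicCompletion K) →+ localPoints V (v.adicCompletion K))
    (hfE : ∀ (τ : absoluteGaloisGroup (v.adicCompletion K)) (P : localPoints V (v.adicCompletion K)), fE (τ • P) = τ • fE P)
    (hfEπ : ∀ P : V.geomPoints, fE (pointsMap V (v.adicCompletion K) P) =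
      pointsMap V (v.adicCompletion K) ((π : AddMonoid.End V.geomPoints) P))
    (Hpts : ∀ y : localPoints V (v.adicCompletion K), (∀ σ : absoluteGaloisGroup (v.adicCompletion K), σ • y = y) →
      ∀ n : ℕ, ∃ (y' : localPoints V (v.adicCompletion K)) (N₁ : ℤ) (k : ℕ),
        (∀ σ : absoluteGaloisGroup (v.adicCompletion K), σ • y' = y') ∧
        ((N₁ : ℤ_[p]) - (1 - r)) ∈ (Ideal.span {(p : ℤ_[p]) ^ n} : Ideal ℤ_[p]) ∧
        p ^ k • (fE y - N₁ • y - p ^ n • y') = 0) :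
    (((V.kummerMapPInfty p V.zsmul_geomPoints_surjective_holds).range).map
          (resSubgroup ⊤ (V.geomPrimaryTorsion p))).comap
        (resH1Hom (ContinuousMonoidHom.id _) (V.endEigenPrimaryTorsion p π r).subtype (fun _ _ ↦ rfl)) ≤
      (resOfLe ↥(V.endEigenPrimaryTorsion p π r) (inf_le_left : ⊤ ⊓ decomp v ≤ ⊤)).ker :=
  (comap_kummer_le_comap_localKerOver V p π r v).trans
    (comap_localKerOver_le_ker_resOfLe_of_cmScalar V p π r v hinf hsup hunit fE hfE hfEπ Hpts)

end Generic

/-! ## §2 (R-BV) from (F1), (F3), (H2) and (H1-pts) -/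

/-- **(R-BV) OF LEAD g12, VERBATIM, from (F1), (F3), (H2) and the single local CM input (H1-pts) at `v`** — -w7 g2's
`rBV_of_three_factor_values` with its hypotheses (F2) and (H1′) discharged by `padicValNat_trueSelmer_quotient_eq_sha_of_frame_of_cmScalar`
(p670747) and `comap_kummer_le_ker_resOfLe_of_cmScalar`. Remaining inputs: (F1) `v₂ #(Q_M ⊓ ker loc_{v̄}) = ℓ + e₁([d]₂)`, (F3)
`v₂ #loc_v(𝔖_{v̄}(K, W*)) = ℓ + e₃([d]₂)`, (H2) `loc_{v̄}(𝔖_v ⊓ L_M) ⊆ loc_{v̄}(Q_M)`, (H1-pts). Conclusion: (R-BV) with `eK := e₁ + e₃`.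
[cite: Agboola2007, Props. 6.10, 6.11, 8.1 (arXiv p0014–p0017)] [cite: GreenbergLNM1716, §2] -/
theorem rBV_of_factor_values_of_cmScalar
    (hF1 : ∃ e₁ : ℤ → ℤ → ℤ, ∀ (d : ℤ), d ≠ 0 → Squarefree d → d % 4 ≠ 1 →
      ∀ (W : WeierstrassCurve ℚ) [W.IsElliptic] [W.IsGloballyMinimal] (C : WeierstrassCurve.VariableChange ℚ),
        C • W = cm7.quadraticTwist (d : ℚ) → W.analyticRank = 1 →
      ∀ (K : Type) [Field K] [NumberField K], IsImaginaryQuadratic K →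
      ∀ (v vbar : HeightOneSpectrum (𝓞 K)),
        ((2 : ℕ) : 𝓞 K) ∈ v.asIdeal → ((2 : ℕ) : 𝓞 K) ∈ vbar.asIdeal → vbar ≠ v →
      ∀ (π : (W.baseChange K).endRing), (π : AddMonoid.End (W.baseChange K).geomPoints) * π = π - 2 →
      ∀ (r : ℤ_[2]), r * r = r - 2 →
        (∀ τ ∈ GreenbergSelmer.inertia v, ∀ x : ↥((W.baseChange K).endEigenPrimaryTorsion 2 π r), τ • x = x ∨ τ • x = -x) →
      ∀ (P : W.toAffine.Point) (c₀ : ℕ) (ℓ : ℤ),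
        ¬ IsOfFinAddOrder P →
        (∀ R : W.toAffine.Point, ∃ (k : ℤ) (T : W.toAffine.Point), IsOfFinAddOrder T ∧ R = k • P + T) →
        c₀ ≠ 0 → (W.baseChange ℚ_[2]).IsInReductionKernel (c₀ • W.toPadicPoint 2 P) →
        ‖(W.baseChange ℚ_[2]).padicLogPoint (c₀ • W.toPadicPoint 2 P) / (c₀ : ℚ_[2])‖ = (2 : ℝ) ^ (-ℓ) →
      Finite (restrictedSelmerBase ↥((W.baseChange K).endEigenPrimaryTorsion 2 π r) 2 vbar) →
        (padicValNat 2 (Nat.card ↥(((((W.baseChange K).kummerMapPInfty 2 (W.baseChange K).zsmul_geomPoints_surjective_holds).range).map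
            (resSubgroup ⊤ ((W.baseChange K).geomPrimaryTorsion 2))).comap
          (resH1Hom (ContinuousMonoidHom.id _) ((W.baseChange K).endEigenPrimaryTorsion 2 π r).subtype (fun _ _ ↦ rfl)) ⊓
          (resOfLe ↥((W.baseChange K).endEigenPrimaryTorsion 2 π r) (inf_le_left : ⊤ ⊓ decomp vbar ≤ ⊤)).ker)) : ℤ) = ℓ + e₁ (d % 2) ((d / (2 - d % 2)) % 8))
    (hF3 : ∃ e₃ : ℤ → ℤ → ℤ, ∀ (d : ℤ), d ≠ 0 → Squarefree d → d % 4 ≠ 1 →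
      ∀ (W : WeierstrassCurve ℚ) [W.IsElliptic] [W.IsGloballyMinimal] (C : WeierstrassCurve.VariableChange ℚ),
        C • W = cm7.quadraticTwist (d : ℚ) → W.analyticRank = 1 →
      ∀ (K : Type) [Field K] [NumberField K], IsImaginaryQuadratic K →
      ∀ (v vbar : HeightOneSpectrum (𝓞 K)),
        ((2 : ℕ) : 𝓞 K) ∈ v.asIdeal → ((2 : ℕ) : 𝓞 K) ∈ vbar.asIdeal → vbar ≠ v →
      ∀ (π : (W.baseChange K).endRing), (π : AddMonoid.End (W.baseChange K).geomPoints) * π = π - 2 →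
      ∀ (r : ℤ_[2]), r * r = r - 2 →
        (∀ τ ∈ GreenbergSelmer.inertia v, ∀ x : ↥((W.baseChange K).endEigenPrimaryTorsion 2 π r), τ • x = x ∨ τ • x = -x) →
      ∀ (P : W.toAffine.Point) (c₀ : ℕ) (ℓ : ℤ),
        ¬ IsOfFinAddOrder P →
        (∀ R : W.toAffine.Point, ∃ (k : ℤ) (T : W.toAffine.Point), IsOfFinAddOrder T ∧ R = k • P + T) →
        c₀ ≠ 0 → (W.baseChange ℚ_[2]).IsInReductionKernel (c₀ • W.toPadicPoint 2 P) →
        ‖(W.baseChange ℚ_[2]).padicLogPoint (c₀ • W.toPadicPoint 2 P) / (c₀ : ℚ_[2])‖ = (2 : ℝ) ^ (-ℓ) →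
      Finite (restrictedSelmerBase ↥((W.baseChange K).endEigenPrimaryTorsion 2 π r) 2 vbar) →
        (padicValNat 2 (Nat.card ((resOfLe ↥((W.baseChange K).endEigenPrimaryTorsion 2 π r) (inf_le_left : ⊤ ⊓ decomp v ≤ ⊤)).comp
          (restrictedSelmerBase ↥((W.baseChange K).endEigenPrimaryTorsion 2 π r) 2 vbar).subtype).range) : ℤ) = ℓ + e₃ (d % 2) ((d / (2 - d % 2)) % 8))
    (hH2 : ∀ (d : ℤ), d ≠ 0 → Squarefree d → d % 4 ≠ 1 →
      ∀ (W : WeierstrassCurve ℚ) [W.IsElliptic] [W.IsGloballyMinimal] (C : WeierstrassCurve.VariableChange ℚ),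
        C • W = cm7.quadraticTwist (d : ℚ) → W.analyticRank = 1 →
      ∀ (K : Type) [Field K] [NumberField K], IsImaginaryQuadratic K →
      ∀ (v vbar : HeightOneSpectrum (𝓞 K)),
        ((2 : ℕ) : 𝓞 K) ∈ v.asIdeal → ((2 : ℕ) : 𝓞 K) ∈ vbar.asIdeal → vbar ≠ v →
      ∀ (π : (W.baseChange K).endRing), (π : AddMonoid.End (W.baseChange K).geomPoints) * π = π - 2 →
      ∀ (r : ℤ_[2]), r * r = r - 2 →
        (∀ τ ∈ GreenbergSelmer.inertia v, ∀ x : ↥((W.baseChange K).endEigenPrimaryTorsion 2 π r), τ • x = x ∨ τ • x = -x) →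
      ∀ (P : W.toAffine.Point) (c₀ : ℕ) (ℓ : ℤ),
        ¬ IsOfFinAddOrder P →
        (∀ R : W.toAffine.Point, ∃ (k : ℤ) (T : W.toAffine.Point), IsOfFinAddOrder T ∧ R = k • P + T) →
        c₀ ≠ 0 → (W.baseChange ℚ_[2]).IsInReductionKernel (c₀ • W.toPadicPoint 2 P) →
        ‖(W.baseChange ℚ_[2]).padicLogPoint (c₀ • W.toPadicPoint 2 P) / (c₀ : ℚ_[2])‖ = (2 : ℝ) ^ (-ℓ) →
      Finite (restrictedSelmerBase ↥((W.baseChange K).endEigenPrimaryTorsion 2 π r) 2 vbar) →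
        (restrictedSelmerBase ↥((W.baseChange K).endEigenPrimaryTorsion 2 π r) 2 v ⊓
            (((W.baseChange K).localKerOver 2 ⊤ (vbar.adicCompletion K)).comap
          (resH1Hom (ContinuousMonoidHom.id _) ((W.baseChange K).endEigenPrimaryTorsion 2 π r).subtype (fun _ _ ↦ rfl)))).map
            (resOfLe ↥((W.baseChange K).endEigenPrimaryTorsion 2 π r) (inf_le_left : ⊤ ⊓ decomp vbar ≤ ⊤)) ≤
          (((((W.baseChange K).kummerMapPInfty 2 (W.baseChange K).zsmul_geomPoints_surjective_holds).range).map
            (resSubgroup ⊤ ((W.baseChange K).geomPrimaryTorsion 2))).comap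
          (resH1Hom (ContinuousMonoidHom.id _) ((W.baseChange K).endEigenPrimaryTorsion 2 π r).subtype (fun _ _ ↦ rfl))).map
            (resOfLe ↥((W.baseChange K).endEigenPrimaryTorsion 2 π r) (inf_le_left : ⊤ ⊓ decomp vbar ≤ ⊤)))
    (hPts : ∀ (d : ℤ), d ≠ 0 → Squarefree d → d % 4 ≠ 1 →
      ∀ (W : WeierstrassCurve ℚ) [W.IsElliptic] [W.IsGloballyMinimal] (C : WeierstrassCurve.VariableChange ℚ),
        C • W = cm7.quadraticTwist (d : ℚ) → W.analyticRank = 1 →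
      ∀ (K : Type) [Field K] [NumberField K], IsImaginaryQuadratic K →
      ∀ (v vbar : HeightOneSpectrum (𝓞 K)),
        ((2 : ℕ) : 𝓞 K) ∈ v.asIdeal → ((2 : ℕ) : 𝓞 K) ∈ vbar.asIdeal → vbar ≠ v →
      ∀ (π : (W.baseChange K).endRing), (π : AddMonoid.End (W.baseChange K).geomPoints) * π = π - 2 →
      ∀ (r : ℤ_[2]), r * r = r - 2 →
        (∀ τ ∈ GreenbergSelmer.inertia v, ∀ x : ↥((W.baseChange K).endEigenPrimaryTorsion 2 π r), τ • x = x ∨ τ • x = -x) →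
      ∀ (P : W.toAffine.Point) (c₀ : ℕ) (ℓ : ℤ),
        ¬ IsOfFinAddOrder P →
        (∀ R : W.toAffine.Point, ∃ (k : ℤ) (T : W.toAffine.Point), IsOfFinAddOrder T ∧ R = k • P + T) →
        c₀ ≠ 0 → (W.baseChange ℚ_[2]).IsInReductionKernel (c₀ • W.toPadicPoint 2 P) →
        ‖(W.baseChange ℚ_[2]).padicLogPoint (c₀ • W.toPadicPoint 2 P) / (c₀ : ℚ_[2])‖ = (2 : ℝ) ^ (-ℓ) →
      Finite (restrictedSelmerBase ↥((W.baseChange K).endEigenPrimaryTorsion 2 π r) 2 vbar) →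
        ∃ fE : localPoints (W.baseChange K) (v.adicCompletion K) →+ localPoints (W.baseChange K) (v.adicCompletion K),
          (∀ (τ : absoluteGaloisGroup (v.adicCompletion K)) (Q : localPoints (W.baseChange K) (v.adicCompletion K)),
              fE (τ • Q) = τ • fE Q) ∧
          (∀ Q : (W.baseChange K).geomPoints, fE (pointsMap (W.baseChange K) (v.adicCompletion K) Q) =
              pointsMap (W.baseChange K) (v.adicCompletion K) ((π : AddMonoid.End (W.baseChange K).geomPoints) Q)) ∧
          ∀ y : localPoints (W.baseChange K) (v.adicCompletion K),
            (∀ σ : absoluteGaloisGroup (v.adicCompletion K), σ • y = y) →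
            ∀ n : ℕ, ∃ (y' : localPoints (W.baseChange K) (v.adicCompletion K)) (N₁ : ℤ) (k : ℕ),
              (∀ σ : absoluteGaloisGroup (v.adicCompletion K), σ • y' = y') ∧
              ((N₁ : ℤ_[2]) - (1 - r)) ∈ (Ideal.span {(2 : ℤ_[2]) ^ n} : Ideal ℤ_[2]) ∧
              2 ^ k • (fE y - N₁ • y - 2 ^ n • y') = 0) :
    ∃ eK : ℤ → ℤ → ℤ, ∀ (d : ℤ), d ≠ 0 → Squarefree d → d % 4 ≠ 1 →
      ∀ (W : WeierstrassCurve ℚ) [W.IsElliptic] [W.IsGloballyMinimal] (C : WeierstrassCurve.VariableChange ℚ),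
        C • W = cm7.quadraticTwist (d : ℚ) → W.analyticRank = 1 →
      ∀ (K : Type) [Field K] [NumberField K], IsImaginaryQuadratic K →
      ∀ (v vbar : HeightOneSpectrum (𝓞 K)),
        ((2 : ℕ) : 𝓞 K) ∈ v.asIdeal → ((2 : ℕ) : 𝓞 K) ∈ vbar.asIdeal → vbar ≠ v →
      ∀ (π : (W.baseChange K).endRing), (π : AddMonoid.End (W.baseChange K).geomPoints) * π = π - 2 →
      ∀ (r : ℤ_[2]), r * r = r - 2 →
        (∀ τ ∈ GreenbergSelmer.inertia v, ∀ x : ↥((W.baseChange K).endEigenPrimaryTorsion 2 π r), τ • x = x ∨ τ • x = -x) →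
      ∀ (P : W.toAffine.Point) (c₀ : ℕ) (ℓ : ℤ),
        ¬ IsOfFinAddOrder P →
        (∀ R : W.toAffine.Point, ∃ (k : ℤ) (T : W.toAffine.Point), IsOfFinAddOrder T ∧ R = k • P + T) →
        c₀ ≠ 0 → (W.baseChange ℚ_[2]).IsInReductionKernel (c₀ • W.toPadicPoint 2 P) →
        ‖(W.baseChange ℚ_[2]).padicLogPoint (c₀ • W.toPadicPoint 2 P) / (c₀ : ℚ_[2])‖ = (2 : ℝ) ^ (-ℓ) →
      Finite (restrictedSelmerBase ↥((W.baseChange K).endEigenPrimaryTorsion 2 π r) 2 vbar) →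
        (padicValNat 2 (Nat.card (restrictedSelmerBase ↥((W.baseChange K).endEigenPrimaryTorsion 2 π r) 2 vbar)) : ℤ) =
          (padicValNat 2 (Nat.card (AddCommGroup.primaryComponent W.sha 2)) : ℤ) + 2 * ℓ + eK (d % 2) ((d / (2 - d % 2)) % 8) := by
  refine rBV_of_three_factor_values hF1 ?_ hF3 ?_ hH2
  · intro d hd0 hsq hd4 W _ _ C hC hrank K _ _ hK v vbar hv hvbar hne π hπ r hr hpin P c₀ ℓ hP hgen hc₀ hker hlog hfin
    exact padicValNat_trueSelmer_quotient_eq_sha_of_frame_of_cmScalar hd0 W C hC hK v vbar hv hvbar hne π hπ hr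
      (hPts d hd0 hsq hd4 W C hC hrank K hK v vbar hv hvbar hne π hπ r hr hpin P c₀ ℓ hP hgen hc₀ hker hlog hfin)
  · intro d hd0 hsq hd4 W _ _ C hC hrank K _ _ hK v vbar hv hvbar hne π hπ r hr hpin P c₀ ℓ hP hgen hc₀ hker hlog hfin
    obtain ⟨fE, hfE, hfEπ, H⟩ := hPts d hd0 hsq hd4 W C hC hrank K hK v vbar hv hvbar hne π hπ r hr hpin P c₀ ℓ hP hgen hc₀ hker hlog hfin
    obtain ⟨hinf, hsup⟩ := endEigenPrimaryTorsion_compl_of_frame hd0 W C hC K π hπ hr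
    exact comap_kummer_le_ker_resOfLe_of_cmScalar (W.baseChange K) 2 π r v hinf hsup (two_dvd_or_two_dvd_one_sub_of_root hr).2
      fE hfE hfEπ H

end Summit.BirchSwinnertonDyer.BirchSwinnertonDyer.Theorems.PrintCf2.CMPrimes

end
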